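import Summits.QuantumAdvantage.QuantumAdvantage.Theorems.SosSandwichTransferPBWalkDefs
import Summits.QuantumAdvantage.QuantumAdvantage.Theorems.SosSandwichTransferPBDescentWidth
import Summits.QuantumAdvantage.QuantumAdvantage.Theorems.SosSandwichTransferPBAdvisedWalk
import HarnessLib

/-!
# Crux `TransferPB` (stmt-QuantumAdvantage-15238, route SosSandwich), line `birth` — the string walk IS the advised tree; the stub from a STRING machine

Machine half of stub `stub_pbOracleSimulation`, index-free and tree-free form. With the string-level walk
`strWalk` and `meanCount` of `Theorems/SosSandwichTransferPBWalkDefs.lean`: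

* `encPath_eq_encPathS`, `encBlock_eq_encBlockS`, `encSingleStr_eq_encSingleS`, `encMean_eq_encMeanS` — the
  instance encodings at an index path `ρ` are the string encodings at `strPath F x ρ`;
* `descentAdvisor_pick_of_none` / `descentAdvisor_pick_of_some`, `descentAdvisor_val_eq_meanCount` — the descent
  advisor read at the string path;
* **`eval_advTree_descentAdvisor`** — for EVERY `g` and any bit reader agreeing with `oracleBits F x A` on the
  relevant strings, `(advTree (descentAdvisor F x g) D ρ).eval (oracleBits F x A) = meanCount(strWalk … D (strPath ρ))/40`;
  `decide_eval_advTree_descentAdvisor` — the threshold bit is `[20 ≤ meanCount (strWalk g x W 𝟙_A D [])]`;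
* `strWalk_eq_of_le` — under consistency the walk is unchanged for any width over-estimate `W' ≥ W`
  (`Theorems/SosSandwichTransferPBDescentWidth.lean`);
* **`stub_pbOracleSimulation_of_stringMachines`** — the registered stub follows from (Q) `nodeProblem ∈ PromiseBQP`
  and (M_str): ONE polynomial-time transcript machine `C` with, for every `x` (`n ≥ 1`) and every `g` consistent
  with `nodeProblem F r c k`, some `W' ≥ oracleWidth F x` and `D ≥ machineBudget F x r c k` such that
  `C^{A ⊕ g}(x) = [20 ≤ meanCount g x (strWalk g x W' 𝟙_A D [])]` for every `A`.

(M_str) mentions no `Fin` index, no polynomial and no decision tree: it is the bare implementation statement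
(an `OracleAlg` replaying the walk — BLOCK/SINGLE queries `true :: encBlockS/encSingleS`, one `A`-query
`false :: u` per round answered by `𝟙_A u`, forty MEAN queries `true :: encMeanS` — plus `IsPolyTime`, e.g. via
the state-machine toolkit `Literature/Computability/Complexity/OracleStateMachine.lean`, with the round budget
polynomial by `Theorems/SosSandwichTransferPBDescentBound.lean`). All proved here; no named fact.
Source: S. Aaronson, A. Ambainis, Theory Comput. 10 (2014), proof of Thm. 23 (p. 14).
-/

-- D-0017: single-conjunct summit ⇒ the duplicate `QuantumAdvantage.QuantumAdvantage` is mandated.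
set_option linter.dupNamespace false

noncomputable section

namespace Summit.QuantumAdvantage.QuantumAdvantage.Cruxes.TransferPB.Birth

open Finset Literature.Computability.Cryptography Literature.Computability.Complexity
  Literature.Computability.QuantumComplexity Literature.Computability.QuantumComplexity.ClassicalSimulation
open Summit.QuantumAdvantage.QuantumAdvantage.Theses.SosSandwich

namespace SimTreePB

section EncS

variable (F : QCircuitFamily cliffordT) (x : List Bool)

/-- `encPath` is `encPathS` of the string path. [folklore] -/
theorem encPath_eq_encPathS : ∀ ρ : List (Fin (numOracleBits F x) × Bool), encPath F x ρ = encPathS (strPath F x ρ)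
  | [] => rfl
  | e :: ρ => by
    show boolPair (e.2 :: bitString F x e.1) (encPath F x ρ) = boolPair (e.2 :: bitString F x e.1) (encPathS (strPath F x ρ))
    rw [encPath_eq_encPathS ρ]

/-- `encBlock` at the string path. [folklore] -/
theorem encBlock_eq_encBlockS (ρ : List (Fin (numOracleBits F x) × Bool)) (u : List Bool) :
    encBlock F x ρ u = encBlockS x (strPath F x ρ) u := by
  unfold encBlock encBlockS; rw [encPath_eq_encPathS]

/-- `encSingleStr` at the string path. [folklore] -/
theorem encSingleStr_eq_encSingleS (ρ : List (Fin (numOracleBits F x) × Bool)) (u : List Bool) :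
    encSingleStr F x ρ u = encSingleS x (strPath F x ρ) u := by
  unfold encSingleStr encSingleS; rw [encPath_eq_encPathS]

/-- `encMean` at the string path. [folklore] -/
theorem encMean_eq_encMeanS (ρ : List (Fin (numOracleBits F x) × Bool)) (j : ℕ) :
    encMean F x ρ j = encMeanS x (strPath F x ρ) j := by
  unfold encMean encMeanS; rw [encPath_eq_encPathS]

/-- The revealed strings of the string path. [folklore] -/
theorem map_fst_strPath (ρ : List (Fin (numOracleBits F x) × Bool)) :
    (strPath F x ρ).map Prod.fst = ρ.map fun e => bitString F x e.1 := by
  simp [strPath]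

/-- `strPath` of an extended path. [folklore] -/
theorem strPath_append_singleton (ρ : List (Fin (numOracleBits F x) × Bool)) (s : Fin (numOracleBits F x)) (b : Bool) :
    strPath F x (ρ ++ [(s, b)]) = strPath F x ρ ++ [(bitString F x s, b)] := by
  simp [strPath]

/-- `strPath [] = []`. [folklore] -/
@[simp] theorem strPath_nil : strPath F x ([] : List (Fin (numOracleBits F x) × Bool)) = [] := rfl

end EncS

section WalkLemmas

variable {F : QCircuitFamily cliffordT} {x : List Bool} {g : List Bool → Bool}

/-- The descent advisor REFUSES when the string-level descent at the string path refuses. [folklore] -/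
theorem descentAdvisor_pick_of_none {ρ : List (Fin (numOracleBits F x) × Bool)}
    (hd : descentPick (fun u => g (encBlockS x (strPath F x ρ) u)) (fun u => g (encSingleS x (strPath F x ρ) u))
        (oracleWidth F x) ((strPath F x ρ).map Prod.fst) = none) :
    (descentAdvisor F x g).pick ρ = none := by
  have hb : (fun u => g (encBlock F x ρ u)) = fun u => g (encBlockS x (strPath F x ρ) u) :=
    funext fun u => by rw [encBlock_eq_encBlockS]
  have hs : (fun u => g (encSingleStr F x ρ u)) = fun u => g (encSingleS x (strPath F x ρ) u) :=
    funext fun u => by rw [encSingleStr_eq_encSingleS]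
  rw [map_fst_strPath, ← hb, ← hs] at hd
  unfold descentAdvisor
  dsimp only
  split
  · rfl
  · rename_i u hu
    rw [hd] at hu
    exact absurd hu (by simp)

/-- The descent advisor PICKS the bit named by the string the string-level descent picks. [folklore] -/
theorem descentAdvisor_pick_of_some {ρ : List (Fin (numOracleBits F x) × Bool)} {u : List Bool}
    (hd : descentPick (fun u => g (encBlockS x (strPath F x ρ) u)) (fun u => g (encSingleS x (strPath F x ρ) u))
        (oracleWidth F x) ((strPath F x ρ).map Prod.fst) = some u) (hW : u.length < oracleWidth F x) :
    (descentAdvisor F x g).pick ρ = some (bitEquiv F x ⟨u, mem_shortStrings.2 hW⟩) := by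
  have hb : (fun u => g (encBlock F x ρ u)) = fun u => g (encBlockS x (strPath F x ρ) u) :=
    funext fun u => by rw [encBlock_eq_encBlockS]
  have hs : (fun u => g (encSingleStr F x ρ u)) = fun u => g (encSingleS x (strPath F x ρ) u) :=
    funext fun u => by rw [encSingleStr_eq_encSingleS]
  rw [map_fst_strPath, ← hb, ← hs] at hd
  unfold descentAdvisor
  dsimp only
  split
  · rename_i hnone
    rw [hd] at hnone
    exact absurd hnone (by simp)
  · rename_i u' hu'
    rw [hd] at hu'
    simp only [Option.some.injEq] at hu'
    subst hu'
    rw [dif_pos hW]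

/-- The descent advisor's leaf value is `meanCount/40` at the string path. [folklore] -/
theorem descentAdvisor_val_eq_meanCount (ρ : List (Fin (numOracleBits F x) × Bool)) :
    (descentAdvisor F x g).val ρ = (meanCount g x (strPath F x ρ) : ℝ) / 40 := by
  rw [descentAdvisor_val_eq]
  unfold meanCount
  have h : ((Icc 1 40).filter fun j => g (encMean F x ρ j) = true) =
      ((Icc 1 40).filter fun j => g (encMeanS x (strPath F x ρ) j) = true) :=
    Finset.filter_congr fun j _ => by rw [encMean_eq_encMeanS]
  rw [h]

/-- **The advised tree of the descent advisor evaluates to `meanCount/40` at the end of the string walk**, for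
ANY oracle-bit reader `inA` that agrees with `oracleBits F x A` on the relevant strings and EVERY answer
function `g`. [cite: AaronsonAmbainis2014, Thm. 23 (proof, p. 14)] -/
theorem eval_advTree_descentAdvisor {A : Set (List Bool)} {inA : List Bool → Bool}
    (hA : ∀ s : Fin (numOracleBits F x), inA (bitString F x s) = oracleBits F x A s) :
    ∀ (D : ℕ) (ρ : List (Fin (numOracleBits F x) × Bool)),
      (advTree (descentAdvisor F x g) D ρ).eval (oracleBits F x A) =
        (meanCount g x (strWalk g x (oracleWidth F x) inA D (strPath F x ρ)) : ℝ) / 40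
  | 0, ρ => by rw [advTree_eval_zero', descentAdvisor_val_eq_meanCount]; rfl
  | D + 1, ρ => by
    cases hd : descentPick (fun u => g (encBlockS x (strPath F x ρ) u)) (fun u => g (encSingleS x (strPath F x ρ) u))
        (oracleWidth F x) ((strPath F x ρ).map Prod.fst) with
    | none =>
      rw [advTree_eval_succ_none _ (descentAdvisor_pick_of_none hd), descentAdvisor_val_eq_meanCount]
      simp only [strWalk, hd]
    | some u =>
      obtain ⟨hW, -, -, -⟩ := descentPick_some_spec hd
      rw [advTree_eval_succ_some _ (descentAdvisor_pick_of_some hd hW), eval_advTree_descentAdvisor hA D,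
        strPath_append_singleton, bitString_bitEquiv hW, ← hA, bitString_bitEquiv hW]
      simp only [strWalk, hd]

/-- The oracle bits as the indicator of `A` on the relevant strings. [folklore] -/
theorem boolIndicator_bitString (A : Set (List Bool)) (s : Fin (numOracleBits F x)) :
    A.boolIndicator (bitString F x s) = oracleBits F x A s := by
  rcases Bool.eq_false_or_eq_true (oracleBits F x A s) with h | h
  · rw [h]; exact (Set.mem_iff_boolIndicator A _).1 ((oracleBits_eq_true_iff F x A s).1 h)
  · rw [h]
    refine (Set.notMem_iff_boolIndicator A _).1 fun hm => ?_
    have := (oracleBits_eq_true_iff F x A s).2 hm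
    rw [h] at this
    exact Bool.false_ne_true this

/-- The threshold bit of `meanCount/40` at `1/2` is `[20 ≤ meanCount]`. [folklore] -/
theorem decide_half_le_meanCount_div (m : ℕ) :
    decide ((1 : ℝ) / 2 ≤ (m : ℝ) / 40) = decide (20 ≤ m) := by
  by_cases h : 20 ≤ m
  · rw [decide_eq_true h, decide_eq_true]
    have : (20 : ℝ) ≤ m := by exact_mod_cast h
    linarith
  · rw [decide_eq_false h, decide_eq_false]
    have : (m : ℝ) < 20 := by exact_mod_cast (not_le.1 h)
    intro h'; linarith

/-- **The machine's output in string terms**: the threshold bit of the advised tree of the descent advisor at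
the bits of `A` is `[20 ≤ meanCount]` at the end of the walk reading `A` through its indicator. [folklore] -/
theorem decide_eval_advTree_descentAdvisor (A : Set (List Bool)) (D : ℕ) :
    decide ((1 : ℝ) / 2 ≤ (advTree (descentAdvisor F x g) D []).eval (oracleBits F x A)) =
      decide (20 ≤ meanCount g x (strWalk g x (oracleWidth F x) (fun u => A.boolIndicator u) D [])) := by
  rw [eval_advTree_descentAdvisor (inA := fun u => A.boolIndicator u) (boolIndicator_bitString A) D [], strPath_nil,
    decide_half_le_meanCount_div]

/-! ### Over-estimated width along the walk -/

variable {r : Polynomial ℕ} {c k : ℕ}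

/-- **The walk is unchanged for any over-estimate `W' ≥ W` of the width** (under consistency), from any index
path. [folklore] -/
theorem strWalk_eq_of_le (hgn : ∀ v ∈ (nodeProblem F r c k).no, g v = false) (inA : List Bool → Bool) {W' : ℕ}
    (hW : oracleWidth F x ≤ W') :
    ∀ (D : ℕ) (ρ : List (Fin (numOracleBits F x) × Bool)),
      strWalk g x W' inA D (strPath F x ρ) = strWalk g x (oracleWidth F x) inA D (strPath F x ρ)
  | 0, _ => rfl
  | D + 1, ρ => by
    have hb : (fun u => g (encBlockS x (strPath F x ρ) u)) = fun u => g (encBlock F x ρ u) :=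
      funext fun u => by rw [encBlock_eq_encBlockS]
    have heq : descentPick (fun u => g (encBlockS x (strPath F x ρ) u)) (fun u => g (encSingleS x (strPath F x ρ) u))
          W' ((strPath F x ρ).map Prod.fst) =
        descentPick (fun u => g (encBlockS x (strPath F x ρ) u)) (fun u => g (encSingleS x (strPath F x ρ) u))
          (oracleWidth F x) ((strPath F x ρ).map Prod.fst) := by
      rw [hb]; exact descentPick_eq_of_le hgn ρ _ _ hW
    simp only [strWalk]
    rw [heq]
    cases hd : descentPick (fun u => g (encBlockS x (strPath F x ρ) u)) (fun u => g (encSingleS x (strPath F x ρ) u))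
        (oracleWidth F x) ((strPath F x ρ).map Prod.fst) with
    | none => rfl
    | some u =>
      obtain ⟨hu, -, -, -⟩ := descentPick_some_spec hd
      simp only
      rw [← bitString_bitEquiv hu, ← strPath_append_singleton, strWalk_eq_of_le hgn inA hW D]

end WalkLemmas

/-! ### The stub from (Q) and a STRING machine -/

/-- **`stub_pbOracleSimulation` from (Q) and (M_str).** If (Q) `nodeProblem F r c k ∈ PromiseBQP` for all
`c, k`, uniform `F`, `r`, and (M_str) for the same data ONE polynomial-time transcript machine `C` (query
lengths `≤ q(n)`) satisfies: for every `x` with `n ≥ 1` and every `g` CONSISTENT with `nodeProblem F r c k`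
there are a width bound `W' ≥ oracleWidth F x` and a budget `D ≥ machineBudget F x r c k` such that for every
oracle `A`, `C^{A ⊕ g}(x) = [20 ≤ meanCount g x (strWalk g x W' (𝟙_A) D [])]` — the machine runs the string
walk (descent with BLOCK/SINGLE queries `true :: instance`, one `A`-query `false :: u` per round) and the forty
MEAN queries — then the registered stub `Sig.stub_pbOracleSimulation` holds. Index-free and tree-free: this is
the implementation statement left to the machine builder. [cite: AaronsonAmbainis2014, Thm. 23 (proof, p. 14)] -/
theorem stub_pbOracleSimulation_of_stringMachines
    (hQ : ∀ (c k : ℕ) (F : QCircuitFamily cliffordT), F.IsUniform → ∀ r : Polynomial ℕ,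
      nodeProblem F r c k ∈ Literature.Computability.Cryptography.PromiseBQP)
    (hM : ∀ (c k : ℕ) (F : QCircuitFamily cliffordT), F.IsUniform → ∀ r : Polynomial ℕ,
      ∃ (C : OracleAlg Bool) (q : Polynomial ℕ),
        C.IsPolyTime Computability.encodingBoolBool ∧
        (∀ (O : Oracle) (x : List Bool), ∀ y ∈ C.queries O (q.eval x.length) x, y.length ≤ q.eval x.length) ∧
        ∀ x : List Bool, 1 ≤ x.length → ∀ g : List Bool → Bool,
          (∀ v ∈ (nodeProblem F r c k).yes, g v = true) → (∀ v ∈ (nodeProblem F r c k).no, g v = false) →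
          ∃ (W' D : ℕ), oracleWidth F x ≤ W' ∧ machineBudget F x r c k ≤ D ∧
            ∀ A : Set (List Bool),
              C.run (Oracle.ofLanguage {w : List Bool | ∃ v : List Bool,
                  (w = false :: v ∧ v ∈ A) ∨ (w = true :: v ∧ g v = true)}) (q.eval x.length) x =
                some (decide (20 ≤ meanCount g x (strWalk g x W' (fun u => A.boolIndicator u) D [])))) :
    Sig.stub_pbOracleSimulation := by
  refine stub_pbOracleSimulation_of_descentMachines hQ fun c k F hF r => ?_
  obtain ⟨C, q, hCpoly, hCq, hrun⟩ := hM c k F hF r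
  refine ⟨C, q, hCpoly, hCq, fun x hx g hgy hgn => ?_⟩
  obtain ⟨W', D, hW, hD, hrunA⟩ := hrun x hx g hgy hgn
  refine ⟨D, hD, fun A => ?_⟩
  rw [hrunA A, decide_eval_advTree_descentAdvisor, ← strPath_nil F x,
    strWalk_eq_of_le hgn (fun u => A.boolIndicator u) hW D []]

end SimTreePB

end Summit.QuantumAdvantage.QuantumAdvantage.Cruxes.TransferPB.Birth

end
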